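import Literature.NumberTheory.LFunctions.AriasDeReynaRemainderBound
import Mathlib.Analysis.SpecialFunctions.Trigonometric.ArctanDeriv
import Mathlib.Analysis.SpecialFunctions.Complex.Arg
import Mathlib.Analysis.SpecialFunctions.Log.Deriv
import Mathlib.Analysis.Calculus.Deriv.MeanValue
import Mathlib.Analysis.Complex.ExponentialBounds
import HarnessLib

/-!
# The weight `W = |ζ|²(1 + V(ζ))` on Arias de Reyna's line `L`: closed form and elementary bounds

Topic `Literature/NumberTheory/LFunctions` (namespace `Literature.NumberTheory.LFunctions.AriasDeReyna`).
Arias de Reyna's Thm. 4.2 (the remainder of the Riemann–Siegel expansion) rests on three numerical constants of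
the weight `W(y) = |ζ|²(1 + V(ζ))`, `ζ = ζ(y) = ½ + (1+i)y/2`, `V = Re f` on his line `L`
(`AriasDeReynaRemainderBound.lean` takes them as hypotheses: `W ≥ 0.1316`, `∫ dy/W ≤ 15`, `|1−ζ|² ≤ 6.15 W`).
This file prepares their proof:

* `wL_eq_closedForm` — the source's closed form of `1 + V(ζ)` on `L`, here as
  `W(y) = T₁(y) − g(y) θ(y) − k(y) ℓ(y)` with `T₁ = (2y²−2y−3)/8`, `g = 2y(1+y)/D`, `k = (1+2y)/D`,
  `D = 2y²+2y+1 = 4|ζ|²`, `θ = arg(1−ζ)` (the source's `arctan(1−2y) − π/4`), `ℓ = log|1−ζ| = ½ log(E/4)`,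
  `E = 2y²−2y+1`;
* `thetaL_of_lt_one` / `thetaL_of_one_lt` / `neg_thetaL_of_pos` — `θ` through `arctan`, and its monotonicity;
* elementary inequalities `arctan x ≤ x − x³/3 + x⁵/5`, `x − x³/3 + x⁵/5 − x⁷/7 ≤ arctan x` (`x ≥ 0`),
  `log x ≥ 2r + (2/3)r³`, `r = (x−1)/(x+1)` (`x ≥ 1`) with reduction by powers of `2` (Mathlib's `log 2` to 9
  places), monotonicity of `g`, `k`, `E`;
* the resulting explicit LINEAR minorants of `W` on an interval `[p, q]` in the four outer regimes
  (`wL_ge_regionA`: `y ≤ −1`; `wL_ge_regionB1`: `0 ≤ y ≤ ½`; `wL_ge_regionB2a`/`b`: `y ≥ ½` with `ℓ ≤ 0`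
  resp. `ℓ` of either sign) and on the tails (`W ≥ y²/4` for `y ≤ −10`, `W ≥ y²/4.5` for `y ≥ 10`);
* `PieceOK p q α β` — the certificate of one piece (a linear minorant with endpoint checks) and what it yields:
  `W ≥ 0.1316` and `|1−ζ|² ≤ 6.15 W` on the piece (`PieceOK.pointwise`, concavity of `6.15·linear − E/4`) and the
  trapezoid bound `∫_p^q dy/W ≤ (q−p)/2 (1/ℓ(p) + 1/ℓ(q))` (`PieceOK.integral_le`, convexity of `1/linear`).

The pieces themselves are in `AriasDeReynaLinePolynomial.lean` (near the minimum, by a polynomial minorant) and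
`AriasDeReynaLineNumerics.lean` (outer regions, assembly). Everything is proved; no named facts.

## References

* J. Arias de Reyna, *High precision computation of Riemann's zeta function by the Riemann–Siegel
  formula, I*, Math. Comp. 80 (2011), 995–1009: proof of Thm. 4.2, p. 1002 (the closed form of `1 + V(ζ)` on
  `L` and the constants `7.489341`, `9.577048`, `5.78453`). [AriasDeReyna2011]
-/

noncomputable section

open Complex MeasureTheory Set Filter Real
open scoped Topology

namespace Literature.NumberTheory.LFunctions

namespace AriasDeReyna

/-! ## Elementary inequalities for `arctan` and `log` -/

/-- `arctan x ≤ x − x³/3 + x⁵/5` for `x ≥ 0` (alternating series). [folklore] -/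
private lemma arctan_le_poly5 {x : ℝ} (hx : 0 ≤ x) : Real.arctan x ≤ x - x ^ 3 / 3 + x ^ 5 / 5 := by
  let F : ℝ → ℝ := fun x ↦ x - x ^ 3 / 3 + x ^ 5 / 5 - Real.arctan x
  have hd : ∀ x, HasDerivAt F (x ^ 6 / (1 + x ^ 2)) x := by
    intro x
    have h := (((hasDerivAt_id' x).sub ((hasDerivAt_pow 3 x).div_const 3)).add
      ((hasDerivAt_pow 5 x).div_const 5)).sub (Real.hasDerivAt_arctan x)
    refine h.congr_deriv ?_
    have : (1 : ℝ) + x ^ 2 ≠ 0 := by positivity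
    field_simp
    push_cast
    ring
  have hmono : Monotone F := by
    refine monotone_of_deriv_nonneg (fun x ↦ (hd x).differentiableAt) fun x ↦ ?_
    rw [(hd x).deriv]
    positivity
  have h := hmono hx
  simp only [F, Real.arctan_zero] at h
  norm_num at h
  linarith

/-- `x − x³/3 + x⁵/5 − x⁷/7 ≤ arctan x` for `x ≥ 0` (alternating series). [folklore] -/
private lemma poly7_le_arctan {x : ℝ} (hx : 0 ≤ x) : x - x ^ 3 / 3 + x ^ 5 / 5 - x ^ 7 / 7 ≤ Real.arctan x := by
  let F : ℝ → ℝ := fun x ↦ Real.arctan x - (x - x ^ 3 / 3 + x ^ 5 / 5 - x ^ 7 / 7)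
  have hd : ∀ x, HasDerivAt F (x ^ 8 / (1 + x ^ 2)) x := by
    intro x
    have h := (Real.hasDerivAt_arctan x).sub ((((hasDerivAt_id' x).sub ((hasDerivAt_pow 3 x).div_const 3)).add
      ((hasDerivAt_pow 5 x).div_const 5)).sub ((hasDerivAt_pow 7 x).div_const 7))
    refine h.congr_deriv ?_
    have : (1 : ℝ) + x ^ 2 ≠ 0 := by positivity
    field_simp
    push_cast
    ring
  have hmono : Monotone F := by
    refine monotone_of_deriv_nonneg (fun x ↦ (hd x).differentiableAt) fun x ↦ ?_
    rw [(hd x).deriv]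
    positivity
  have h := hmono hx
  simp only [F, Real.arctan_zero] at h
  norm_num at h
  linarith

/-- The rational minorant `2r + (2/3)r³`, `r = (x−1)/(x+1)`, of `log x` for `x ≥ 1` (`log x = 2 artanh r`).
[folklore] -/
def logLB (x : ℝ) : ℝ := 2 * ((x - 1) / (x + 1)) + 2 / 3 * ((x - 1) / (x + 1)) ^ 3

/-- `2r + (2/3)r³ ≤ log x` for `x ≥ 1`, `r = (x−1)/(x+1)`. [folklore] -/
private lemma logLB_le_log {x : ℝ} (hx : 1 ≤ x) : logLB x ≤ Real.log x := by
  let F : ℝ → ℝ := fun x ↦ Real.log x - (2 * ((x - 1) / (x + 1)) + 2 / 3 * ((x - 1) / (x + 1)) ^ 3)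
  have hd : ∀ x, 0 < x → HasDerivAt F ((x - 1) ^ 4 / (x * (x + 1) ^ 4)) x := by
    intro x hx0
    have hx1 : x + 1 ≠ 0 := by linarith
    have hr : HasDerivAt (fun x : ℝ ↦ (x - 1) / (x + 1)) (2 / (x + 1) ^ 2) x := by
      have := ((hasDerivAt_id' x).sub_const 1).div ((hasDerivAt_id' x).add_const 1) hx1
      refine this.congr_deriv ?_
      field_simp
      ring
    have hr3 : HasDerivAt (fun x : ℝ ↦ ((x - 1) / (x + 1)) ^ 3) (3 * ((x - 1) / (x + 1)) ^ 2 * (2 / (x + 1) ^ 2)) x := by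
      have := hr.pow 3
      refine this.congr_deriv ?_
      norm_num
    have h := (Real.hasDerivAt_log hx0.ne').sub ((hr.const_mul 2).add (hr3.const_mul (2 / 3)))
    refine h.congr_deriv ?_
    have hx0' : x ≠ 0 := hx0.ne'
    field_simp
    ring
  have hmono : MonotoneOn F (Ici 1) := by
    refine monotoneOn_of_deriv_nonneg (convex_Ici 1) ?_ ?_ fun x hx ↦ ?_
    · exact fun x hx ↦ (hd x (by linarith [mem_Ici.1 hx])).continuousAt.continuousWithinAt
    · intro x hx
      rw [interior_Ici] at hx
      exact (hd x (by linarith [mem_Ioi.1 hx])).differentiableAt.differentiableWithinAt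
    · rw [interior_Ici] at hx
      have hx0 : 0 < x := by linarith [mem_Ioi.1 hx]
      rw [(hd x hx0).deriv]
      positivity
  have h := hmono (self_mem_Ici) (mem_Ici.2 hx) hx
  simp only [F, Real.log_one] at h
  norm_num at h
  rw [logLB]
  linarith

/-- `log x ≥ m·0.6931471803 + (2r + (2/3)r³)(x/2^m)` for `x ≥ 2^m` (reduction by `log 2 > 0.6931471803`).
[folklore] -/
private lemma log_ge_reduce (m : ℕ) {x : ℝ} (hx : (2 : ℝ) ^ m ≤ x) :
    (m : ℝ) * 0.6931471803 + logLB (x / 2 ^ m) ≤ Real.log x := by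
  have h2m : (0 : ℝ) < 2 ^ m := by positivity
  have hx0 : 0 < x := lt_of_lt_of_le h2m hx
  have hsplit : Real.log x = m * Real.log 2 + Real.log (x / 2 ^ m) := by
    rw [Real.log_div hx0.ne' h2m.ne', Real.log_pow]; ring
  rw [hsplit]
  have h1 : logLB (x / 2 ^ m) ≤ Real.log (x / 2 ^ m) := logLB_le_log (by rwa [le_div_iff₀ h2m, one_mul])
  have h2 := Real.log_two_gt_d9
  have h3 : (m : ℝ) * 0.6931471803 ≤ m * Real.log 2 := mul_le_mul_of_nonneg_left h2.le (Nat.cast_nonneg m)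
  linarith

/-- `log x ≤ m·0.6931471808 + (x/2^m − 1)` for `x ≥ 2^m` (`log 2 < 0.6931471808`, `log u ≤ u − 1`).
[folklore] -/
private lemma log_le_reduce (m : ℕ) {x : ℝ} (hx : (2 : ℝ) ^ m ≤ x) :
    Real.log x ≤ (m : ℝ) * 0.6931471808 + (x / 2 ^ m - 1) := by
  have h2m : (0 : ℝ) < 2 ^ m := by positivity
  have hx0 : 0 < x := lt_of_lt_of_le h2m hx
  have hsplit : Real.log x = m * Real.log 2 + Real.log (x / 2 ^ m) := by
    rw [Real.log_div hx0.ne' h2m.ne', Real.log_pow]; ring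
  rw [hsplit]
  have h1 : Real.log (x / 2 ^ m) ≤ x / 2 ^ m - 1 := Real.log_le_sub_one_of_pos (by positivity)
  have h2 := Real.log_two_lt_d9
  have h3 : (m : ℝ) * Real.log 2 ≤ m * 0.6931471808 := mul_le_mul_of_nonneg_left h2.le (Nat.cast_nonneg m)
  linarith


/-! ## The closed form of `W` on `L` -/

/-- `D(y) = 2y² + 2y + 1 = 4|ζ(y)|²`. [cite: AriasDeReyna2011, proof of Thm. 4.2 ("`(1+y)² + y²`")] -/
def dL (y : ℝ) : ℝ := 2 * y ^ 2 + 2 * y + 1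

/-- `E(y) = 2y² − 2y + 1 = 4|1 − ζ(y)|²`. [cite: AriasDeReyna2011, proof of Thm. 4.2 ("`(1−y)² + y²`")] -/
def eL (y : ℝ) : ℝ := 2 * y ^ 2 - 2 * y + 1

/-- The polynomial part `T₁(y) = (2y² − 2y − 3)/8 = |ζ|²/2 − Re ζ` of `W`. [cite: AriasDeReyna2011, proof of Thm. 4.2 (the displayed formula for `1 + V(ζ)`)] -/
def tOne (y : ℝ) : ℝ := (2 * y ^ 2 - 2 * y - 3) / 8

/-- The coefficient `g(y) = 2y(1+y)/D(y)` of `−arg(1−ζ)` in `W`. [cite: AriasDeReyna2011, proof of Thm. 4.2 (the term `8(y+y²)/((1+y)²+y²)²`)] -/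
def gL (y : ℝ) : ℝ := 2 * y * (1 + y) / dL y

/-- The coefficient `k(y) = (1+2y)/D(y)` of `−log|1−ζ|` in `W`. [cite: AriasDeReyna2011, proof of Thm. 4.2 (the term `2(1+2y)/((1+y)²+y²)²`)] -/
def kL (y : ℝ) : ℝ := (1 + 2 * y) / dL y

/-- `θ(y) = arg(1 − ζ(y))` (the source's `arctan(1 − 2y) − π/4`). [cite: AriasDeReyna2011, proof of Thm. 4.2] -/
def thetaL (y : ℝ) : ℝ := Complex.arg (1 - lineL y)

/-- `ℓ(y) = log|1 − ζ(y)| = ½ log(E(y)/4)`. [cite: AriasDeReyna2011, proof of Thm. 4.2] -/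
def ellL (y : ℝ) : ℝ := Real.log ‖1 - lineL y‖

/-- `D > 0`. [cite: AriasDeReyna2011, proof of Thm. 4.2] -/
lemma dL_pos (y : ℝ) : 0 < dL y := by unfold dL; nlinarith [sq_nonneg (y + 1 / 2)]

/-- `E > 0`. [cite: AriasDeReyna2011, proof of Thm. 4.2] -/
lemma eL_pos (y : ℝ) : 0 < eL y := by unfold eL; nlinarith [sq_nonneg (y - 1 / 2)]

/-- `|ζ(y)|² = D(y)/4`. [cite: AriasDeReyna2011, proof of Thm. 4.2] -/
lemma normSq_lineL_eq_dL (y : ℝ) : ‖lineL y‖ ^ 2 = dL y / 4 := by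
  rw [normSq_lineL_ofReal, dL]; ring

/-- `|1 − ζ(y)|² = E(y)/4`. [cite: AriasDeReyna2011, proof of Thm. 4.2] -/
lemma normSq_one_sub_lineL_eq_eL (y : ℝ) : ‖1 - lineL y‖ ^ 2 = eL y / 4 := by
  rw [normSq_one_sub_lineL_ofReal, eL]; ring

/-- `ℓ(y) = ½ log(E(y)/4)`. [cite: AriasDeReyna2011, proof of Thm. 4.2] -/
lemma ellL_eq (y : ℝ) : ellL y = 1 / 2 * Real.log (eL y / 4) := by
  rw [ellL, ← normSq_one_sub_lineL_eq_eL, Real.log_pow]; push_cast; ring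

/-- **The closed form of the weight**: `W(y) = T₁(y) − g(y) θ(y) − k(y) ℓ(y)`, i.e. the source's
`|ζ|²(1 + V(ζ))` with `1 + V = ½ − 2(1+y)/D − 8(y+y²)θ'/D² − 2(1+2y) log(E/4)/D²` (`θ' = arctan(1−2y) − π/4 = θ`).
[cite: AriasDeReyna2011, proof of Thm. 4.2 (the displayed formula for `1 + V(ζ)` on `L`)] -/
theorem wL_eq_closedForm (y : ℝ) : wL y = tOne y - gL y * thetaL y - kL y * ellL y := by
  have hζD := lineL_ofReal_mem_cutPlane y
  have hζ0 := lineL_ofReal_ne_zero y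
  set ζ : ℂ := lineL y with hζ
  have hre : ζ.re = (1 + y) / 2 := by rw [hζ, lineL_re]; simp
  have him : ζ.im = y / 2 := by rw [hζ, lineL_im]; simp
  have h2re : (ζ ^ 2).re = ((1 + y) / 2) ^ 2 - (y / 2) ^ 2 := by rw [pow_two, Complex.mul_re, hre, him]; ring
  have h2im : (ζ ^ 2).im = 2 * ((1 + y) / 2) * (y / 2) := by rw [pow_two, Complex.mul_im, hre, him]; ring
  have hnsq : Complex.normSq ζ = dL y / 4 := by rw [Complex.normSq_apply, hre, him, dL]; ring
  have hnsq2 : Complex.normSq (ζ ^ 2) = (dL y / 4) ^ 2 := by rw [map_pow, hnsq]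
  have hD := dL_pos y
  have hlog_re : (Complex.log (1 - ζ)).re = ellL y := by rw [Complex.log_re, ellL]
  have hlog_im : (Complex.log (1 - ζ)).im = thetaL y := by rw [Complex.log_im, thetaL]
  have hf : (fKer ζ).re = -(ellL y * (((1 + y) / 2) ^ 2 - (y / 2) ^ 2) + thetaL y * (2 * ((1 + y) / 2) * (y / 2))) /
      (dL y / 4) ^ 2 - ((1 + y) / 2) / (dL y / 4) - 1 / 2 := by
    rw [fKer_eq_log hζD hζ0]
    have e1 : (-Complex.log (1 - ζ) / ζ ^ 2).re =
        -(ellL y * (((1 + y) / 2) ^ 2 - (y / 2) ^ 2) + thetaL y * (2 * ((1 + y) / 2) * (y / 2))) / (dL y / 4) ^ 2 := by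
      rw [Complex.div_re, Complex.neg_re, Complex.neg_im, hlog_re, hlog_im, h2re, h2im, hnsq2]; ring
    have e2 : ((1 : ℂ) / ζ).re = ((1 + y) / 2) / (dL y / 4) := by
      rw [Complex.div_re, Complex.one_re, Complex.one_im, hre, him, hnsq]; ring
    have e3 : ((1 : ℂ) / 2).re = 1 / 2 := by norm_num
    rw [Complex.sub_re, Complex.sub_re, e1, e2, e3]
  rw [wL, ← hζ, Complex.sq_norm, hnsq, hf, tOne, gL, kL]
  field_simp
  simp only [dL]
  ring

/-! ## The argument `θ(y) = arg(1 − ζ(y))` -/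

/-- For `y < 1`: `θ(y) = −arctan(y/(1−y))` (`Re(1−ζ) = (1−y)/2 > 0`). [cite: AriasDeReyna2011, proof of Thm. 4.2] -/
theorem thetaL_of_lt_one {y : ℝ} (hy : y < 1) : thetaL y = -Real.arctan (y / (1 - y)) := by
  set w : ℂ := 1 - lineL y with hw
  have hre : w.re = (1 - y) / 2 := by rw [hw, Complex.sub_re, lineL_re]; simp; ring
  have him : w.im = -(y / 2) := by rw [hw, Complex.sub_im, lineL_im]; simp
  have hpos : 0 < w.re := by rw [hre]; linarith
  have habs : |Complex.arg w| < π / 2 := Complex.abs_arg_lt_pi_div_two_iff.2 (Or.inl hpos)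
  have h1 : Real.arctan (Real.tan (Complex.arg w)) = Complex.arg w :=
    Real.arctan_tan (by linarith [neg_lt_of_abs_lt habs]) (lt_of_abs_lt habs)
  rw [thetaL, ← hw, ← h1, Complex.tan_arg, hre, him, ← Real.arctan_neg]
  congr 1
  have : (1 - y) ≠ 0 := by linarith
  field_simp

/-- For `y > 1`: `θ(y) = arctan(y/(y−1)) − π` (`1 − ζ` in the third quadrant). [cite: AriasDeReyna2011, proof of Thm. 4.2] -/
theorem thetaL_of_one_lt {y : ℝ} (hy : 1 < y) : thetaL y = Real.arctan (y / (y - 1)) - π := by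
  set v : ℂ := lineL y - 1 with hv
  have hre : v.re = (y - 1) / 2 := by rw [hv, Complex.sub_re, lineL_re]; simp; ring
  have him : v.im = y / 2 := by rw [hv, Complex.sub_im, lineL_im]; simp
  have hpos : 0 < v.re := by rw [hre]; linarith
  have himpos : 0 < v.im := by rw [him]; linarith
  have habs : |Complex.arg v| < π / 2 := Complex.abs_arg_lt_pi_div_two_iff.2 (Or.inl hpos)
  have h1 : Real.arctan (Real.tan (Complex.arg v)) = Complex.arg v :=
    Real.arctan_tan (by linarith [neg_lt_of_abs_lt habs]) (lt_of_abs_lt habs)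
  have hneg : 1 - lineL (y : ℂ) = -v := by rw [hv]; ring
  rw [thetaL, hneg, Complex.arg_neg_eq_arg_sub_pi_of_im_pos himpos, ← h1, Complex.tan_arg, hre, him]
  congr 2
  have : (y - 1) ≠ 0 := by linarith
  field_simp

/-- At `y = 1`: `θ(1) = −π/2` (`1 − ζ(1) = −i/2`). [cite: AriasDeReyna2011, proof of Thm. 4.2] -/
theorem thetaL_one : thetaL 1 = -(π / 2) := by
  rw [thetaL, Complex.arg_eq_neg_pi_div_two_iff]
  refine ⟨?_, ?_⟩
  · rw [Complex.sub_re, show ((1 : ℝ) : ℂ) = 1 by simp, lineL_re]; simp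
  · rw [Complex.sub_im, show ((1 : ℝ) : ℂ) = 1 by simp, lineL_im]; norm_num

/-- For `y > 0`: `−θ(y) = π/2 + arctan((y−1)/y)` (one formula across `y = 1`). [cite: AriasDeReyna2011, proof of Thm. 4.2] -/
theorem neg_thetaL_of_pos {y : ℝ} (hy : 0 < y) : -thetaL y = π / 2 + Real.arctan ((y - 1) / y) := by
  rcases lt_trichotomy y 1 with h | h | h
  · rw [thetaL_of_lt_one h, neg_neg]
    have hx : 0 < (1 - y) / y := div_pos (by linarith) hy
    have e : y / (1 - y) = ((1 - y) / y)⁻¹ := by rw [inv_div]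
    rw [e, Real.arctan_inv_of_pos hx, show (y - 1) / y = -((1 - y) / y) by ring, Real.arctan_neg]
    ring
  · subst h; rw [thetaL_one]; simp
  · rw [thetaL_of_one_lt h]
    have hx : 0 < (y - 1) / y := div_pos (by linarith) hy
    have e : y / (y - 1) = ((y - 1) / y)⁻¹ := by rw [inv_div]
    rw [e, Real.arctan_inv_of_pos hx]
    ring

/-- For `y ≤ 0`: `θ(y) = arctan(|y|/(1+|y|)) ≥ 0`. [cite: AriasDeReyna2011, proof of Thm. 4.2] -/
lemma thetaL_nonneg {y : ℝ} (hy : y ≤ 0) : 0 ≤ thetaL y := by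
  rw [thetaL_of_lt_one (by linarith), ← Real.arctan_neg, ← Real.arctan_zero]
  refine Real.arctan_mono ?_
  have : y / (1 - y) ≤ 0 := div_nonpos_of_nonpos_of_nonneg hy (by linarith)
  linarith

/-- Monotonicity for `y ≤ 0`: `θ` is non-increasing in `y` on `(−∞, 1)`, so on `[p, q]` it is at most
`θ(p) ≤ U₅(−p/(1−p))` (`U₅(s) = s − s³/3 + s⁵/5 ≥ arctan s`). [cite: AriasDeReyna2011, proof of Thm. 4.2] -/
lemma thetaL_le_of_le {p y : ℝ} (hpy : p ≤ y) (hy : y ≤ 0) :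
    thetaL y ≤ (-p / (1 - p)) - (-p / (1 - p)) ^ 3 / 3 + (-p / (1 - p)) ^ 5 / 5 := by
  rw [thetaL_of_lt_one (by linarith), ← Real.arctan_neg]
  have hs : -(y / (1 - y)) ≤ -p / (1 - p) := by
    rw [neg_div, neg_le_neg_iff, div_le_div_iff₀ (by linarith) (by linarith)]
    nlinarith
  have hp0 : 0 ≤ -p / (1 - p) := div_nonneg (by linarith) (by linarith)
  exact (Real.arctan_mono hs).trans (arctan_le_poly5 hp0)

/-- `θ ≤ π/2` for `y < 1` (`Re(1 − ζ) > 0`). [cite: AriasDeReyna2011, proof of Thm. 4.2] -/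
lemma thetaL_le_pi_div_two {y : ℝ} (hy : y < 1) : thetaL y ≤ π / 2 := by
  rw [thetaL, Complex.arg_le_pi_div_two_iff]
  left
  rw [Complex.sub_re, show ((1 : ℂ)).re = 1 by simp, lineL_re]; simp; linarith

/-- Monotonicity for `y > 0`: `−θ` is non-decreasing in `y`, so on `[p, q]` (`p > 0`) it is at least
`−θ(p) = π/2 + arctan((p−1)/p)`. [cite: AriasDeReyna2011, proof of Thm. 4.2] -/
lemma neg_thetaL_ge_of_le {p y : ℝ} (hp : 0 < p) (hpy : p ≤ y) :
    π / 2 + Real.arctan ((p - 1) / p) ≤ -thetaL y := by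
  rw [neg_thetaL_of_pos (lt_of_lt_of_le hp hpy)]
  have hy : 0 < y := lt_of_lt_of_le hp hpy
  have : (p - 1) / p ≤ (y - 1) / y := by
    rw [div_le_div_iff₀ hp hy]; nlinarith
  linarith [Real.arctan_mono this]

/-- The three usable forms of the lower bound for `−θ(p)`, `p > 0`: `π/4` at `p = 1/2`; `π/2 − U₅((1−p)/p)` for
`p < 1`; `π/2 + L₇((p−1)/p)` for `p ≥ 1` (`L₇(t) = t − t³/3 + t⁵/5 − t⁷/7 ≤ arctan t`), with `π > 3.141592`.
[cite: AriasDeReyna2011, proof of Thm. 4.2] -/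
lemma neg_thetaL_ge_half {y : ℝ} (hy : 1 / 2 ≤ y) : 3.141592 / 4 ≤ -thetaL y := by
  have h := neg_thetaL_ge_of_le (by norm_num : (0:ℝ) < 1 / 2) hy
  rw [show ((1 / 2 : ℝ) - 1) / (1 / 2) = -1 by norm_num, Real.arctan_neg, Real.arctan_one] at h
  linarith [Real.pi_gt_d6]

/-- For `0 < p ≤ 1`, `p ≤ y`: `−θ(y) ≥ π/2 − U₅((1−p)/p)` with `π > 3.141592`. [cite: AriasDeReyna2011, proof of Thm. 4.2] -/
lemma neg_thetaL_ge_of_lt_one {p y : ℝ} (hp : 0 < p) (hp1 : p ≤ 1) (hpy : p ≤ y) :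
    3.141592 / 2 - (((1 - p) / p) - ((1 - p) / p) ^ 3 / 3 + ((1 - p) / p) ^ 5 / 5) ≤ -thetaL y := by
  have h := neg_thetaL_ge_of_le hp hpy
  have hx : 0 ≤ (1 - p) / p := div_nonneg (by linarith) hp.le
  have h2 := arctan_le_poly5 hx
  rw [show (p - 1) / p = -((1 - p) / p) by ring, Real.arctan_neg] at h
  linarith [Real.pi_gt_d6]

/-- For `1 ≤ p ≤ y`: `−θ(y) ≥ π/2 + L₇((p−1)/p)` with `π > 3.141592`. [cite: AriasDeReyna2011, proof of Thm. 4.2] -/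
lemma neg_thetaL_ge_of_one_le {p y : ℝ} (hp1 : 1 ≤ p) (hpy : p ≤ y) :
    3.141592 / 2 + (((p - 1) / p) - ((p - 1) / p) ^ 3 / 3 + ((p - 1) / p) ^ 5 / 5 - ((p - 1) / p) ^ 7 / 7)
      ≤ -thetaL y := by
  have hp : 0 < p := by linarith
  have h := neg_thetaL_ge_of_le hp hpy
  have hx : 0 ≤ (p - 1) / p := div_nonneg (by linarith) hp.le
  have h2 := poly7_le_arctan hx
  linarith [Real.pi_gt_d6]

/-- For `0 < p ≤ y < 1`: `−θ(y) ≥ L₇(p/(1−p))` (the form used on `(0, 1/2]`). [cite: AriasDeReyna2011, proof of Thm. 4.2] -/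
lemma neg_thetaL_ge_small {p y : ℝ} (hp : 0 ≤ p) (hpy : p ≤ y) (hy : y < 1) :
    (p / (1 - p)) - (p / (1 - p)) ^ 3 / 3 + (p / (1 - p)) ^ 5 / 5 - (p / (1 - p)) ^ 7 / 7 ≤ -thetaL y := by
  rw [thetaL_of_lt_one hy, neg_neg]
  have hs : p / (1 - p) ≤ y / (1 - y) := by
    rw [div_le_div_iff₀ (by linarith) (by linarith)]; nlinarith
  have hx : 0 ≤ p / (1 - p) := div_nonneg hp (by linarith)
  exact (poly7_le_arctan hx).trans (Real.arctan_mono hs)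


/-! ## Monotonicity of the rational coefficients -/

/-- `T₁` is convex: it lies above its tangent at any point `c`. [cite: AriasDeReyna2011, proof of Thm. 4.2] -/
lemma tOne_ge_tangent (c y : ℝ) : tOne c + (2 * c - 1) / 4 * (y - c) ≤ tOne y := by
  unfold tOne; nlinarith [sq_nonneg (y - c)]

/-- `g ≥ 0` for `y ≥ 0` and for `y ≤ −1`. [cite: AriasDeReyna2011, proof of Thm. 4.2] -/
lemma gL_nonneg {y : ℝ} (hy : 0 ≤ y ∨ y ≤ -1) : 0 ≤ gL y := by
  unfold gL
  refine div_nonneg ?_ (dL_pos y).le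
  rcases hy with h | h <;> nlinarith

/-- `g ≤ 1`. [cite: AriasDeReyna2011, proof of Thm. 4.2] -/
lemma gL_le_one (y : ℝ) : gL y ≤ 1 := by
  unfold gL; rw [div_le_one (dL_pos y)]; unfold dL; nlinarith

/-- `g` is non-decreasing on `[0, ∞)`. [cite: AriasDeReyna2011, proof of Thm. 4.2] -/
lemma gL_mono_nonneg {p y : ℝ} (hp : 0 ≤ p) (hpy : p ≤ y) : gL p ≤ gL y := by
  unfold gL
  rw [div_le_div_iff₀ (dL_pos p) (dL_pos y)]
  unfold dL
  nlinarith [mul_nonneg hp (sub_nonneg.2 hpy), mul_nonneg (mul_nonneg hp hp) (sub_nonneg.2 hpy)]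

/-- `g` is non-increasing on `(−∞, −1]`. [cite: AriasDeReyna2011, proof of Thm. 4.2] -/
lemma gL_anti_neg {p y : ℝ} (hpy : p ≤ y) (hy : y ≤ -1) : gL y ≤ gL p := by
  unfold gL
  rw [div_le_div_iff₀ (dL_pos y) (dL_pos p)]
  unfold dL
  -- `2y(1+y)(2p²+2p+1) − 2p(1+p)(2y²+2y+1) = 2(y−p)(y+p+1)`
  nlinarith [mul_nonneg (sub_nonneg.2 hpy) (by linarith : (0:ℝ) ≤ -(y + p + 1))]

/-- `k > 0` for `y ≥ 0`. [cite: AriasDeReyna2011, proof of Thm. 4.2] -/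
lemma kL_pos {y : ℝ} (hy : 0 ≤ y) : 0 < kL y := by
  unfold kL; exact div_pos (by linarith) (dL_pos y)

/-- `−k ≥ 0` for `y ≤ −1/2`. [cite: AriasDeReyna2011, proof of Thm. 4.2] -/
lemma neg_kL_nonneg {y : ℝ} (hy : y ≤ -1 / 2) : 0 ≤ -kL y := by
  unfold kL; rw [← neg_div]; exact div_nonneg (by linarith) (dL_pos y).le

/-- `k` is non-increasing on `[0, ∞)`: `(1+2y)D(p) − (1+2p)D(y) = (p−y)((2p+1)(2y+1) − 1)`.
[cite: AriasDeReyna2011, proof of Thm. 4.2] -/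
lemma kL_anti_nonneg {p y : ℝ} (hp : 0 ≤ p) (hpy : p ≤ y) : kL y ≤ kL p := by
  unfold kL
  rw [div_le_div_iff₀ (dL_pos y) (dL_pos p)]
  unfold dL
  nlinarith [mul_nonneg (sub_nonneg.2 hpy) (by nlinarith : (0:ℝ) ≤ (2 * p + 1) * (2 * y + 1) - 1)]

/-- `−k` is non-decreasing on `(−∞, −1]`. [cite: AriasDeReyna2011, proof of Thm. 4.2] -/
lemma neg_kL_mono_neg {p y : ℝ} (hpy : p ≤ y) (hy : y ≤ -1) : -kL p ≤ -kL y := by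
  unfold kL
  rw [← neg_div, ← neg_div, div_le_div_iff₀ (dL_pos p) (dL_pos y)]
  unfold dL
  nlinarith [mul_nonneg (sub_nonneg.2 hpy) (by nlinarith : (0:ℝ) ≤ (2 * p + 1) * (2 * y + 1) - 1)]

/-- `E` is non-increasing on `(−∞, 1/2]`. [cite: AriasDeReyna2011, proof of Thm. 4.2] -/
lemma eL_anti {y q : ℝ} (hyq : y ≤ q) (hq : q ≤ 1 / 2) : eL q ≤ eL y := by
  unfold eL; nlinarith [mul_nonneg (sub_nonneg.2 hyq) (by linarith : (0:ℝ) ≤ 1 - y - q)]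

/-- `E` is non-decreasing on `[1/2, ∞)`. [cite: AriasDeReyna2011, proof of Thm. 4.2] -/
lemma eL_mono {p y : ℝ} (hpy : p ≤ y) (hp : 1 / 2 ≤ p) : eL p ≤ eL y := by
  unfold eL; nlinarith [mul_nonneg (sub_nonneg.2 hpy) (by linarith : (0:ℝ) ≤ y + p - 1)]

/-- `logLB u ≥ 0` for `u ≥ 1`. [folklore] -/
private lemma logLB_nonneg {u : ℝ} (hu : 1 ≤ u) : 0 ≤ logLB u := by
  unfold logLB
  have : 0 ≤ (u - 1) / (u + 1) := div_nonneg (by linarith) (by linarith)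
  positivity

/-! ## Lower bounds for `W` on the outer regions of `L` -/

/-- **Region `y ≤ −1`**: on `[p, q] ⊆ (−∞, −1]`, `W(y) ≥ T₁(q) + T₁'(q)(y − q) − g(p)U₅(|p|/(1+|p|)) + |k(p)|·½·ℓ_lb(E(q)/4)`
(each of the three terms of the closed form bounded by its monotone factors; `U₅ ≥ arctan`, `ℓ_lb ≤ log` after
reduction by `2^m`). [cite: AriasDeReyna2011, proof of Thm. 4.2] -/
theorem wL_ge_regionA {p q y : ℝ} (hpy : p ≤ y) (hyq : y ≤ q) (hq : q ≤ -1) (m : ℕ)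
    (hm : (2 : ℝ) ^ m ≤ eL q / 4) :
    tOne q + (2 * q - 1) / 4 * (y - q) - gL p * ((-p / (1 - p)) - (-p / (1 - p)) ^ 3 / 3 + (-p / (1 - p)) ^ 5 / 5)
      + (-kL p) * (1 / 2 * ((m : ℝ) * 0.6931471803 + logLB (eL q / 4 / 2 ^ m))) ≤ wL y := by
  rw [wL_eq_closedForm]
  have hy1 : y ≤ -1 := hyq.trans hq
  have h1 := tOne_ge_tangent q y
  -- the `θ`-term
  have hg0 : 0 ≤ gL y := gL_nonneg (Or.inr hy1)
  have hgle : gL y ≤ gL p := gL_anti_neg hpy hy1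
  have hθ0 : 0 ≤ thetaL y := thetaL_nonneg (by linarith)
  have hθle := thetaL_le_of_le hpy (by linarith)
  have h2 : gL y * thetaL y ≤ gL p * ((-p / (1 - p)) - (-p / (1 - p)) ^ 3 / 3 + (-p / (1 - p)) ^ 5 / 5) :=
    mul_le_mul hgle hθle hθ0 (hg0.trans hgle)
  -- the `ℓ`-term
  have hk0 : 0 ≤ -kL p := neg_kL_nonneg (by linarith)
  have hkle : -kL p ≤ -kL y := neg_kL_mono_neg hpy hy1
  have hEq : eL q ≤ eL y := eL_anti hyq (by linarith)
  have h2m : (0 : ℝ) < 2 ^ m := by positivity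
  have hEq1 : 1 ≤ eL q / 4 := le_trans (one_le_pow₀ (by norm_num : (1:ℝ) ≤ 2)) hm
  have hlog : (m : ℝ) * 0.6931471803 + logLB (eL q / 4 / 2 ^ m) ≤ Real.log (eL y / 4) :=
    (log_ge_reduce m hm).trans (Real.log_le_log (by linarith) (by linarith))
  have hlb0 : 0 ≤ (m : ℝ) * 0.6931471803 + logLB (eL q / 4 / 2 ^ m) :=
    add_nonneg (by positivity) (logLB_nonneg (by rwa [le_div_iff₀ h2m, one_mul]))
  have h3 : (-kL p) * (1 / 2 * ((m : ℝ) * 0.6931471803 + logLB (eL q / 4 / 2 ^ m))) ≤ (-kL y) * ellL y := by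
    rw [ellL_eq]
    exact mul_le_mul hkle (by linarith) (by positivity) (hk0.trans hkle)
  linarith

/-- **Region `0 ≤ y ≤ 1/2`**: on `[p, q] ⊆ [0, 1/2]`,
`W(y) ≥ T₁(q) + T₁'(q)(y−q) + g(p)L₇(p/(1−p)) + k(q)·½(2 log 2 + ℓ_lb(1/E(p)))`. [cite: AriasDeReyna2011, proof of Thm. 4.2] -/
theorem wL_ge_regionB1 {p q y : ℝ} (hp : 0 ≤ p) (hpy : p ≤ y) (hyq : y ≤ q) (hq : q ≤ 1 / 2)
    (hc : 0 ≤ (p / (1 - p)) - (p / (1 - p)) ^ 3 / 3 + (p / (1 - p)) ^ 5 / 5 - (p / (1 - p)) ^ 7 / 7) :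
    tOne q + (2 * q - 1) / 4 * (y - q) + gL p * ((p / (1 - p)) - (p / (1 - p)) ^ 3 / 3 + (p / (1 - p)) ^ 5 / 5
      - (p / (1 - p)) ^ 7 / 7) + kL q * (1 / 2 * (2 * 0.6931471803 + logLB (1 / eL p))) ≤ wL y := by
  rw [wL_eq_closedForm]
  have hy0 : 0 ≤ y := hp.trans hpy
  have h1 := tOne_ge_tangent q y
  have hg0 : 0 ≤ gL p := gL_nonneg (Or.inl hp)
  have hgle : gL p ≤ gL y := gL_mono_nonneg hp hpy
  have hθ := neg_thetaL_ge_small hp hpy (by linarith)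
  have h2 : gL p * ((p / (1 - p)) - (p / (1 - p)) ^ 3 / 3 + (p / (1 - p)) ^ 5 / 5 - (p / (1 - p)) ^ 7 / 7)
      ≤ gL y * (-thetaL y) := mul_le_mul hgle hθ hc (hg0.trans hgle)
  have hk0 : 0 < kL q := kL_pos (hy0.trans hyq)
  have hkle : kL q ≤ kL y := kL_anti_nonneg hy0 hyq
  have hEp : 0 < eL p := eL_pos p
  have hEle : eL y ≤ eL p := eL_anti hpy (by linarith)
  have hEy : 0 < eL y := eL_pos y
  have hE1 : eL p ≤ 1 := by unfold eL; nlinarith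
  have h4 : (2 : ℝ) ^ 2 ≤ 4 / eL p := by rw [le_div_iff₀ hEp]; nlinarith
  have hlog : (2 : ℝ) * 0.6931471803 + logLB (1 / eL p) ≤ Real.log (4 / eL y) := by
    have := log_ge_reduce 2 h4
    rw [show (4 : ℝ) / eL p / 2 ^ 2 = 1 / eL p by field_simp; ring] at this
    push_cast at this
    refine this.trans (Real.log_le_log (by positivity) ?_)
    exact div_le_div_of_nonneg_left (by norm_num) hEy hEle
  have hlb0 : 0 ≤ (2 : ℝ) * 0.6931471803 + logLB (1 / eL p) :=
    add_nonneg (by norm_num) (logLB_nonneg (by rw [le_div_iff₀ hEp]; linarith))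
  have hell : -ellL y = 1 / 2 * Real.log (4 / eL y) := by
    rw [ellL_eq, show (4 : ℝ) / eL y = (eL y / 4)⁻¹ by rw [inv_div], Real.log_inv]; ring
  have h3 : kL q * (1 / 2 * (2 * 0.6931471803 + logLB (1 / eL p))) ≤ kL y * (-ellL y) := by
    rw [hell]
    exact mul_le_mul hkle (by linarith) (by positivity) (hk0.le.trans hkle)
  linarith

/-- **Region `y ≥ 1/2`, `E(q) ≤ 4`** (i.e. `q ≤ (1+√7)/2`, where `ℓ ≤ 0`): on `[p, q]`,
`W(y) ≥ T₁(p) + T₁'(p)(y−p) + g(p) c_θ + k(q)·½ ℓ_lb(4/E(q))` for any `c_θ ≥ 0` with `c_θ ≤ −θ` on `[p, ∞)`.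
[cite: AriasDeReyna2011, proof of Thm. 4.2] -/
theorem wL_ge_regionB2a {p q y cθ : ℝ} (hp : 1 / 2 ≤ p) (hpy : p ≤ y) (hyq : y ≤ q)
    (hc0 : 0 ≤ cθ) (hθ : ∀ y, p ≤ y → cθ ≤ -thetaL y) (m : ℕ) (hm : (2 : ℝ) ^ m ≤ 4 / eL q) :
    tOne p + (2 * p - 1) / 4 * (y - p) + gL p * cθ
      + kL q * (1 / 2 * ((m : ℝ) * 0.6931471803 + logLB (4 / eL q / 2 ^ m))) ≤ wL y := by
  rw [wL_eq_closedForm]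
  have hp0 : 0 ≤ p := by linarith
  have hy0 : 0 ≤ y := hp0.trans hpy
  have h1 := tOne_ge_tangent p y
  have hg0 : 0 ≤ gL p := gL_nonneg (Or.inl hp0)
  have hgle : gL p ≤ gL y := gL_mono_nonneg hp0 hpy
  have h2 : gL p * cθ ≤ gL y * (-thetaL y) := mul_le_mul hgle (hθ y hpy) hc0 (hg0.trans hgle)
  have hk0 : 0 < kL q := kL_pos (hy0.trans hyq)
  have hkle : kL q ≤ kL y := kL_anti_nonneg hy0 hyq
  have hEy : 0 < eL y := eL_pos y
  have hEqpos : 0 < eL q := eL_pos q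
  have hEle : eL y ≤ eL q := eL_mono hyq (hp.trans hpy)
  have h2m : (0 : ℝ) < 2 ^ m := by positivity
  have hlog : (m : ℝ) * 0.6931471803 + logLB (4 / eL q / 2 ^ m) ≤ Real.log (4 / eL y) :=
    (log_ge_reduce m hm).trans (Real.log_le_log (by positivity) (div_le_div_of_nonneg_left (by norm_num) hEy hEle))
  have hlb0 : 0 ≤ (m : ℝ) * 0.6931471803 + logLB (4 / eL q / 2 ^ m) :=
    add_nonneg (by positivity) (logLB_nonneg (by rwa [le_div_iff₀ h2m, one_mul]))
  have hell : -ellL y = 1 / 2 * Real.log (4 / eL y) := by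
    rw [ellL_eq, show (4 : ℝ) / eL y = (eL y / 4)⁻¹ by rw [inv_div], Real.log_inv]; ring
  have h3 : kL q * (1 / 2 * ((m : ℝ) * 0.6931471803 + logLB (4 / eL q / 2 ^ m))) ≤ kL y * (-ellL y) := by
    rw [hell]
    exact mul_le_mul hkle (by linarith) (by positivity) (hk0.le.trans hkle)
  linarith

/-- **Region `y ≥ 1/2`, `E(q) ≥ 4`** (where `ℓ` may be positive): on `[p, q]`,
`W(y) ≥ T₁(p) + T₁'(p)(y−p) + g(p) c_θ − k(p)·½ ℓ_ub(E(q)/4)`, `ℓ_ub(x) = m log 2 + x/2^m − 1`.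
[cite: AriasDeReyna2011, proof of Thm. 4.2] -/
theorem wL_ge_regionB2b {p q y cθ : ℝ} (hp : 1 / 2 ≤ p) (hpy : p ≤ y) (hyq : y ≤ q)
    (hc0 : 0 ≤ cθ) (hθ : ∀ y, p ≤ y → cθ ≤ -thetaL y) (m : ℕ) (hm : (2 : ℝ) ^ m ≤ eL q / 4) :
    tOne p + (2 * p - 1) / 4 * (y - p) + gL p * cθ
      - kL p * (1 / 2 * ((m : ℝ) * 0.6931471808 + (eL q / 4 / 2 ^ m - 1))) ≤ wL y := by
  rw [wL_eq_closedForm]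
  have hp0 : 0 ≤ p := by linarith
  have hy0 : 0 ≤ y := hp0.trans hpy
  have h1 := tOne_ge_tangent p y
  have hg0 : 0 ≤ gL p := gL_nonneg (Or.inl hp0)
  have hgle : gL p ≤ gL y := gL_mono_nonneg hp0 hpy
  have h2 : gL p * cθ ≤ gL y * (-thetaL y) := mul_le_mul hgle (hθ y hpy) hc0 (hg0.trans hgle)
  have hkp : 0 < kL p := kL_pos hp0
  have hky0 : 0 < kL y := kL_pos hy0
  have hkle : kL y ≤ kL p := kL_anti_nonneg hp0 hpy
  have hEy : 0 < eL y := eL_pos y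
  have hEle : eL y ≤ eL q := eL_mono hyq (hp.trans hpy)
  have h2m : (0 : ℝ) < 2 ^ m := by positivity
  set U : ℝ := 1 / 2 * ((m : ℝ) * 0.6931471808 + (eL q / 4 / 2 ^ m - 1)) with hU
  have hU0 : 0 ≤ U := by
    have : 1 ≤ eL q / 4 / 2 ^ m := by rwa [le_div_iff₀ h2m, one_mul]
    rw [hU]; nlinarith [Nat.cast_nonneg (α := ℝ) m]
  have h3 : -(kL p * U) ≤ -(kL y * ellL y) := by
    rcases le_or_gt (ellL y) 0 with hl | hl
    · have : kL y * ellL y ≤ 0 := mul_nonpos_of_nonneg_of_nonpos hky0.le hl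
      nlinarith
    · have hlU : ellL y ≤ U := by
        rw [ellL_eq, hU]
        refine mul_le_mul_of_nonneg_left ?_ (by norm_num)
        exact (Real.log_le_log (by positivity) (by linarith)).trans (log_le_reduce m hm)
      nlinarith [mul_le_mul hkle hlU hl.le hkp.le]
  linarith

/-- **Left tail**: `W(y) ≥ y²/4` for `y ≤ −10` (`T₁ − π/2`). [cite: AriasDeReyna2011, proof of Thm. 4.2] -/
theorem wL_ge_tail_left {y : ℝ} (hy : y ≤ -10) : y ^ 2 / 4 ≤ wL y := by
  rw [wL_eq_closedForm]
  have hg0 : 0 ≤ gL y := gL_nonneg (Or.inr (by linarith))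
  have hg1 := gL_le_one y
  have hθ0 : 0 ≤ thetaL y := thetaL_nonneg (by linarith)
  have hθ1 := thetaL_le_pi_div_two (y := y) (by linarith)
  have h2 : gL y * thetaL y ≤ 1 * (π / 2) := mul_le_mul hg1 hθ1 hθ0 zero_le_one
  have hk0 : 0 ≤ -kL y := neg_kL_nonneg (by linarith)
  have hE : 1 ≤ eL y / 4 := by unfold eL; nlinarith
  have hl0 : 0 ≤ ellL y := by rw [ellL_eq]; exact mul_nonneg (by norm_num) (Real.log_nonneg hE)
  have h3 : 0 ≤ (-kL y) * ellL y := mul_nonneg hk0 hl0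
  have hπ := Real.pi_lt_d6
  unfold tOne
  nlinarith

/-- **Right tail**: `W(y) ≥ y²/4.5` for `y ≥ 10` (`T₁ + g(10)(π/2 + L₇(9/10)) − 1/e`, using `ℓ ≤ log y ≤ y/e`).
[cite: AriasDeReyna2011, proof of Thm. 4.2] -/
theorem wL_ge_tail_right {y : ℝ} (hy : 10 ≤ y) : y ^ 2 / 4.5 ≤ wL y := by
  rw [wL_eq_closedForm]
  have hy0 : 0 < y := by linarith
  have hg0 : 0 ≤ gL 10 := gL_nonneg (Or.inl (by norm_num))
  have hgle : gL 10 ≤ gL y := gL_mono_nonneg (by norm_num) hy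
  have hθ := neg_thetaL_ge_of_one_le (by norm_num : (1:ℝ) ≤ 10) hy
  have hg10 : gL 10 = 220 / 221 := by norm_num [gL, dL]
  norm_num at hθ
  have hc0 : (0 : ℝ) ≤ 2.277 := by norm_num
  have h2 : 220 / 221 * 2.277 ≤ gL y * (-thetaL y) := by
    rw [← hg10]; exact mul_le_mul hgle (by linarith) hc0 (hg0.trans hgle)
  -- the `ℓ`-term: `k ℓ ≤ k log y ≤ k y/e ≤ (1+2y)y/(D e) ≤ 1/e`
  have hky : 0 < kL y := kL_pos hy0.le
  have hE4 : eL y / 4 ≤ y ^ 2 := by unfold eL; nlinarith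
  have hly : ellL y ≤ Real.log y := by
    rw [ellL_eq]
    have := Real.log_le_log (by linarith [eL_pos y] : 0 < eL y / 4) hE4
    rw [Real.log_pow] at this; push_cast at this; linarith
  have hlogy : Real.log y ≤ y / Real.exp 1 := by
    have h := Real.log_le_sub_one_of_pos (div_pos hy0 (Real.exp_pos 1))
    rw [Real.log_div hy0.ne' (Real.exp_pos 1).ne', Real.log_exp] at h
    linarith
  have he := Real.exp_one_gt_d9
  have hye : y / Real.exp 1 ≤ y / 2.718 := div_le_div_of_nonneg_left hy0.le (by norm_num) (by linarith)
  have hkD : kL y * y ≤ 1 := by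
    unfold kL; rw [div_mul_eq_mul_div, div_le_one (dL_pos y)]; unfold dL; nlinarith
  have h3 : kL y * ellL y ≤ 1 / 2.718 := by
    calc kL y * ellL y ≤ kL y * (y / 2.718) := mul_le_mul_of_nonneg_left (hly.trans (hlogy.trans hye)) hky.le
      _ = kL y * y / 2.718 := by ring
      _ ≤ 1 / 2.718 := by gcongr
  have key : y ^ 2 / 4.5 ≤ (2 * y ^ 2 - 2 * y - 3) / 8 + 220 / 221 * 2.277 - 1 / 2.718 := by
    norm_num
    nlinarith [sq_nonneg (y / 6 - 3 / 4)]
  unfold tOne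
  linarith

/-! ## From a linear lower bound on a piece to the three numerical statements -/

/-- The data of one piece `[p, q]` of the line: a linear minorant `α + β(y − p) ≤ W(y)` whose endpoint values
dominate `0.1316` and `|1 − ζ|²/6.15`. [cite: AriasDeReyna2011, proof of Thm. 4.2] -/
def PieceOK (p q α β : ℝ) : Prop :=
  p < q ∧ (∀ y ∈ Icc p q, α + β * (y - p) ≤ wL y) ∧ (0.1316 : ℝ) ≤ α ∧ (0.1316 : ℝ) ≤ α + β * (q - p) ∧
    eL p / 4 ≤ 6.15 * α ∧ eL q / 4 ≤ 6.15 * (α + β * (q - p))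

/-- On a piece: `W ≥ 0.1316` and `|1 − ζ|² ≤ 6.15 W` (the second by concavity of `6.15(α + β(y−p)) − E(y)/4`).
[cite: AriasDeReyna2011, proof of Thm. 4.2] -/
theorem PieceOK.pointwise {p q α β : ℝ} (h : PieceOK p q α β) :
    ∀ y ∈ Icc p q, (0.1316 : ℝ) ≤ wL y ∧ ‖1 - lineL y‖ ^ 2 ≤ 6.15 * wL y := by
  obtain ⟨hpq, hlb, h1, h2, h3, h4⟩ := h
  intro y hy
  have hl := hlb y hy
  have hyp : 0 ≤ y - p := by linarith [hy.1]
  have hqy : 0 ≤ q - y := by linarith [hy.2]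
  constructor
  · -- the linear function is at least `0.1316` at both ends
    have : (0.1316 : ℝ) * (q - p) ≤ (α + β * (y - p)) * (q - p) := by nlinarith
    have hqp : 0 < q - p := by linarith
    nlinarith
  · rw [normSq_one_sub_lineL_eq_eL]
    have hqp : 0 < q - p := by linarith
    -- `Q(y) = 6.15(α + β(y−p)) − E(y)/4` is concave with `Q(p), Q(q) ≥ 0`
    have key : (q - p) * (6.15 * (α + β * (y - p)) - eL y / 4) ≥ 0 := by
      have e : (q - p) * (6.15 * (α + β * (y - p)) - eL y / 4) =
          (q - y) * (6.15 * α - eL p / 4) + (y - p) * (6.15 * (α + β * (q - p)) - eL q / 4)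
            + (q - p) * ((y - p) * (q - y) / 2) := by unfold eL; ring
      rw [e]
      have t1 := mul_nonneg hqy (sub_nonneg.2 h3)
      have t2 := mul_nonneg hyp (sub_nonneg.2 h4)
      have t3 : 0 ≤ (q - p) * ((y - p) * (q - y) / 2) := by positivity
      linarith
    have : 0 ≤ 6.15 * (α + β * (y - p)) - eL y / 4 := nonneg_of_mul_nonneg_right (by linarith) hqp
    nlinarith

/-- On a piece: `∫_p^q dy/W ≤ (q − p)/2 · (1/ℓ(p) + 1/ℓ(q))` for the linear minorant `ℓ` (`1/ℓ` is convex, so the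
trapezoid rule over-estimates its integral). [cite: AriasDeReyna2011, proof of Thm. 4.2] -/
theorem PieceOK.integral_le {p q α β : ℝ} (h : PieceOK p q α β) (hWi : Integrable fun y : ℝ ↦ (wL y)⁻¹) :
    ∫ y in p..q, (wL y)⁻¹ ≤ (q - p) / 2 * (1 / α + 1 / (α + β * (q - p))) := by
  obtain ⟨hpq, hlb, h1, h2, -, -⟩ := h
  set H : ℝ := q - p with hH
  have hH0 : 0 < H := by rw [hH]; linarith
  set u : ℝ := α with hu
  set v : ℝ := α + β * H with hv
  have hu0 : 0 < u := by rw [hu]; linarith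
  have hv0 : 0 < v := by rw [hv]; linarith
  -- the chord of `1/ℓ`
  set chord : ℝ → ℝ := fun y ↦ 1 / u + (y - p) * ((1 / v - 1 / u) / H) with hchord
  have hpt : ∀ y ∈ Icc p q, (wL y)⁻¹ ≤ chord y := by
    intro y hy
    set s : ℝ := (y - p) / H with hs
    have hs0 : 0 ≤ s := div_nonneg (by linarith [hy.1]) hH0.le
    have hs1 : s ≤ 1 := by rw [hs, div_le_one hH0]; linarith [hy.2]
    have hℓ : α + β * (y - p) = (1 - s) * u + s * v := by
      rw [hu, hv, hs]; field_simp; ring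
    have hℓpos : 0 < (1 - s) * u + s * v := by nlinarith
    have hW : (1 - s) * u + s * v ≤ wL y := by rw [← hℓ]; exact hlb y hy
    have hWpos : 0 < wL y := lt_of_lt_of_le hℓpos hW
    have hc : chord y = (1 - s) / u + s / v := by
      rw [hchord, hs]; field_simp; ring
    rw [hc]
    calc (wL y)⁻¹ ≤ ((1 - s) * u + s * v)⁻¹ := by
          rw [inv_le_inv₀ hWpos hℓpos]; exact hW
      _ ≤ (1 - s) / u + s / v := by
          rw [inv_le_iff_one_le_mul₀ hℓpos, div_add_div _ _ hu0.ne' hv0.ne', div_mul_eq_mul_div,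
            le_div_iff₀ (mul_pos hu0 hv0)]
          nlinarith [mul_nonneg (mul_nonneg hs0 (sub_nonneg.2 hs1)) (sq_nonneg (u - v))]
  have hci : IntervalIntegrable chord volume p q := by
    refine (Continuous.intervalIntegrable ?_ _ _)
    rw [hchord]; fun_prop
  have hI1 : ∫ y in p..q, (y - p) = H ^ 2 / 2 := by
    rw [intervalIntegral.integral_comp_sub_right (fun x : ℝ ↦ x) p, integral_id, hH]; simp
  have hI2 : ∫ y in p..q, chord y = H / u + H ^ 2 / 2 * ((1 / v - 1 / u) / H) := by
    rw [hchord]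
    simp only
    rw [intervalIntegral.integral_add intervalIntegrable_const
        ((by fun_prop : Continuous fun y : ℝ ↦ (y - p) * ((1 / v - 1 / u) / H)).intervalIntegrable _ _),
      intervalIntegral.integral_const, intervalIntegral.integral_mul_const, hI1, smul_eq_mul, ← hH]
    ring
  calc ∫ y in p..q, (wL y)⁻¹ ≤ ∫ y in p..q, chord y :=
        intervalIntegral.integral_mono_on hpq.le (hWi.intervalIntegrable) hci hpt
    _ = (q - p) / 2 * (1 / α + 1 / (α + β * (q - p))) := by
        rw [hI2, ← hH, hu, hv]
        field_simp
        ring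

end AriasDeReyna

end Literature.NumberTheory.LFunctions
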